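import Mathlib
import HarnessLib
import Literature.MathematicalPhysics.QuantumLattice.ThinSectorFoldOneSided
import Summits.HubbardSuperconductivity.HubbardSuperconductivity.Theorems.KLProgrammeH10TwoPointLimitPerturbedCountFoldSigned
import Summits.HubbardSuperconductivity.HubbardSuperconductivity.Theorems.KLProgrammeH10TwoPointLimitPerturbedCountLipschitz
import Summits.HubbardSuperconductivity.HubbardSuperconductivity.Theorems.KLProgrammeH10TwoPointLimitPerturbedCountPeriodicDeriv

/-!
# Route `KLProgramme` — K3 engine child `KLRegimeEngineV17F2` (stmt-HubbardSuperconductivity-20437), stub (b) import ι₂: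
# the one-sided ROW KILL on the perturbed curve (anti-aligned rows of the fold range carry no cells)

Cell gate-hubbard-kl, plan g17 (R41)(i) «E1-P2-THIN-COUNT» (seat p4; plan HOME/prover-p4/E1-P2-THIN-COUNT-PLAN.md §Refinement 4, part (F3a) perturbed twin).
Twin of `BandSectorCounting.row_kill_anti` (`ThinSectorFoldSignedKey`): along the perturbed anti-diagonal `F(t) = h^E_P(σ − t/2, σ + t/2)`, if the diagonal
value satisfies `δ₀ + δ₁τ < F(0) ≤ η₀/2`, the diagonal slope `|G(0)| ≤ 2λ`, the row is ANTI-aligned with margin on the window (`ι ≤ −I(x)` for the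
DIAGONAL frozen sines, `2S_Eτ < ι` absorbing the drift of the sines along the row), and `M_anti τ² ≤ η₀/2`, `M_Γ τ ≤ 2λ`, then the key hypotheses hold on
the whole row, `F′ ≥ 0` on `[0, τ]` (`anti_key_perturbed_signed` with `s = −1`), and by `gridCount_oneSided_incr` no cell `t = (i+1)w ≤ τ` has
`|F(t)| ≤ δ₀ + δ₁t`.

* `row_kill_anti_perturbed`, `row_kill_aligned_perturbed` (the mirror: `D < −δ′`, aligned, `F′ ≤ 0`).

Everything is PROVED; no definitions.  References: BGM 2006 Lemma 3.1 / App. A2 [cite: BenfattoGiulianiMastropietro2006]; Mastropietro 2008 (14.67)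
p. 223, p. 229 [cite: Mastropietro2008].
-/

noncomputable section

namespace Summit.HubbardSuperconductivity.HubbardSuperconductivity.Theorems.PerturbedFermiCurve

set_option linter.dupNamespace false -- summit = problem name (single-conjunct summit), D-0017

open Real Set
open Literature.MathematicalPhysics.QuantumLattice Literature.MathematicalPhysics.QuantumLattice.BandSectorCounting

section RowKill

variable {a b : ℝ} (B : BandBounds a b) {δ : (Fin 2 → ℝ) → ℝ} (hδs : ContDiff ℝ 2 δ)
  {κ₀ κ₁ κ₂ μ : ℝ} (hδ : ∀ k : Fin 2 → ℝ, |δ k| ≤ κ₀) (hlo : a ≤ μ - κ₀) (hhi : μ + κ₀ ≤ b)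
  (hκ : ∀ k : Fin 2 → ℝ, ‖fderiv ℝ δ k‖ ≤ κ₁) (hκ₁ : κ₁ < B.Dtmin) (hκ₂ : ∀ k : Fin 2 → ℝ, ‖fderiv ℝ (fderiv ℝ δ) k‖ ≤ κ₂)
  {u : ℝ → ℝ} (hu : ∀ θ, IsBandFermiRadius (μ - δ (u θ • dir θ)) θ (u θ))
include B hδs hδ hlo hhi hκ hκ₁ hκ₂ hu

/-- **Row kill on the perturbed curve, anti-aligned (corner-type) row**: no cell of the anti-diagonal through `σ` is admissible at the affine tolerance
`δ₀ + δ₁t` when `δ₀ + δ₁τ < h^E_P(σ,σ) ≤ η₀/2`, `|G(0)| ≤ 2λ`, the row is anti-aligned with margin `ι > 2S_Eτ` on `|x − σ| ≤ τ/2`, and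
`M_anti τ² ≤ η₀/2`, `M_Γ τ ≤ 2λ`. [cite: BenfattoGiulianiMastropietro2006, App. A2] -/
theorem row_kill_anti_perturbed {P : ℝ × ℝ} {σ w τ η₀ lam ι δ₀ δ₁ : ℝ} (hw : 0 < w) (hτ : 0 < τ) (hδ₀ : 0 ≤ δ₀) (hδ₁ : 0 ≤ δ₁)
    (hlo' : a ≤ μ - κ₀ - η₀) (hhi' : μ + κ₀ + η₀ ≤ b)
    (hsmall :
      4 * (κ₁ * (π * Real.sqrt 2 + 2 * B.smax) / (B.Dtmin - κ₁)) * ((B.smax + κ₁ * (π * Real.sqrt 2 + 2 * B.smax) / (B.Dtmin - κ₁)) + B.smax) +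
          (κ₂ * (B.smax + κ₁ * (π * Real.sqrt 2 + 2 * B.smax) / (B.Dtmin - κ₁)) ^ 2 + κ₁ * ((((4 + κ₂) * (B.smax + κ₁ * (π * Real.sqrt 2 + 2 * B.smax) / (B.Dtmin - κ₁)) ^ 2 + (8 + 2 * κ₁) * ((4 + κ₁) * (π * Real.sqrt 2) / (B.Dtmin - κ₁)) + (4 + κ₁) * (π * Real.sqrt 2)) / (B.Dtmin - κ₁)) + 2 * ((4 + κ₁) * (π * Real.sqrt 2) / (B.Dtmin - κ₁)) + π * Real.sqrt 2)) / 2 +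
        2 * ((((4 + κ₂) * (B.smax + κ₁ * (π * Real.sqrt 2 + 2 * B.smax) / (B.Dtmin - κ₁)) ^ 2 + (8 + 2 * κ₁) * ((4 + κ₁) * (π * Real.sqrt 2) / (B.Dtmin - κ₁)) + (4 + κ₁) * (π * Real.sqrt 2)) / (B.Dtmin - κ₁)) + 2 * ((4 + κ₁) * (π * Real.sqrt 2) / (B.Dtmin - κ₁)) + π * Real.sqrt 2) *
          (η₀ / B.Dtmin + 2 * κ₀ / B.Dtmin + B.smax * (B.Cg * ((2 * lam + (4 + κ₁) * ((((4 + κ₂) * (B.smax + κ₁ * (π * Real.sqrt 2 + 2 * B.smax) / (B.Dtmin - κ₁)) ^ 2 + (8 + 2 * κ₁) * ((4 + κ₁) * (π * Real.sqrt 2) / (B.Dtmin - κ₁)) + (4 + κ₁) * (π * Real.sqrt 2)) / (B.Dtmin - κ₁)) + 2 * ((4 + κ₁) * (π * Real.sqrt 2) / (B.Dtmin - κ₁)) + π * Real.sqrt 2) * τ / 2) / 2 + κ₁ * (B.smax + κ₁ * (π * Real.sqrt 2 + 2 * B.smax) / (B.Dtmin - κ₁)) / 2 + 2 * (κ₁ *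 (π * Real.sqrt 2 + 2 * B.smax) / (B.Dtmin - κ₁)) + 2 * B.smax * (η₀ / B.Dtmin) + 2 * B.smax * (2 * κ₀ / B.Dtmin)) + τ / 2)) +
        κ₁ * ((((4 + κ₂) * (B.smax + κ₁ * (π * Real.sqrt 2 + 2 * B.smax) / (B.Dtmin - κ₁)) ^ 2 + (8 + 2 * κ₁) * ((4 + κ₁) * (π * Real.sqrt 2) / (B.Dtmin - κ₁)) + (4 + κ₁) * (π * Real.sqrt 2)) / (B.Dtmin - κ₁)) + 2 * ((4 + κ₁) * (π * Real.sqrt 2) / (B.Dtmin - κ₁)) + π * Real.sqrt 2) / 2 ≤ B.hmin / 2)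
    (hρ : 2 * (η₀ / B.Dtmin + 2 * κ₀ / B.Dtmin + B.smax * (B.Cg * ((2 * lam + (4 + κ₁) * ((((4 + κ₂) * (B.smax + κ₁ * (π * Real.sqrt 2 + 2 * B.smax) / (B.Dtmin - κ₁)) ^ 2 + (8 + 2 * κ₁) * ((4 + κ₁) * (π * Real.sqrt 2) / (B.Dtmin - κ₁)) + (4 + κ₁) * (π * Real.sqrt 2)) / (B.Dtmin - κ₁)) + 2 * ((4 + κ₁) * (π * Real.sqrt 2) / (B.Dtmin - κ₁)) + π * Real.sqrt 2) * τ / 2) / 2 + κ₁ * (B.smax + κ₁ * (π * Real.sqrt 2 + 2 * B.smax) / (B.Dtmin - κ₁)) / 2 + 2 * (κ₁ * (π * Real.sqrt 2 + 2 * B.smax) / (B.Dtmin - κ₁)) + 2 * B.smax * (η₀ / B.Dtmin) + 2 * B.smax * (2 * κ₀ / B.Dtmin)) + τ / 2)) < B.rhomin ^ 2)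
    (hM : 0 < (2 * ((((4 + κ₂) * (B.smax + κ₁ * (π * Real.sqrt 2 + 2 * B.smax) / (B.Dtmin - κ₁)) ^ 2 + (8 + 2 * κ₁) * ((4 + κ₁) * (π * Real.sqrt 2) / (B.Dtmin - κ₁)) + (4 + κ₁) * (π * Real.sqrt 2)) / (B.Dtmin - κ₁)) + 2 * ((4 + κ₁) * (π * Real.sqrt 2) / (B.Dtmin - κ₁)) + π * Real.sqrt 2) + κ₁ * ((((4 + κ₂) * (B.smax + κ₁ * (π * Real.sqrt 2 + 2 * B.smax) / (B.Dtmin - κ₁)) ^ 2 + (8 + 2 * κ₁) * ((4 + κ₁) * (π * Real.sqrt 2) / (B.Dtmin - κ₁)) + (4 + κ₁) * (π * Real.sqrt 2)) / (B.Dtmin - κ₁)) + 2 * ((4 + κ₁) * (π * Real.sqrt 2) / (B.Dtmin - κ₁)) + π * Real.sqrt 2) / 2)) (hMG : 0 < (8 * (B.smax + κ₁ * (π * Real.sqrt 2 + 2 * B.smax) / (B.Dtmin - κ₁)) ^ 2 + 2 * (κ₂ * (B.smax + κ₁ * (π * Real.sqrt 2 + 2 * B.smax) / (B.Dtmin - κ₁))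 ^ 2) + 4 * ((((4 + κ₂) * (B.smax + κ₁ * (π * Real.sqrt 2 + 2 * B.smax) / (B.Dtmin - κ₁)) ^ 2 + (8 + 2 * κ₁) * ((4 + κ₁) * (π * Real.sqrt 2) / (B.Dtmin - κ₁)) + (4 + κ₁) * (π * Real.sqrt 2)) / (B.Dtmin - κ₁)) + 2 * ((4 + κ₁) * (π * Real.sqrt 2) / (B.Dtmin - κ₁)) + π * Real.sqrt 2) + κ₁ * ((((4 + κ₂) * (B.smax + κ₁ * (π * Real.sqrt 2 + 2 * B.smax) / (B.Dtmin - κ₁)) ^ 2 + (8 + 2 * κ₁) * ((4 + κ₁) * (π * Real.sqrt 2) / (B.Dtmin - κ₁)) + (4 + κ₁) * (π * Real.sqrt 2)) / (B.Dtmin - κ₁)) + 2 * ((4 + κ₁) * (π * Real.sqrt 2) / (B.Dtmin - κ₁)) + π * Real.sqrt 2)))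
    (hτη : ((2 * ((((4 + κ₂) * (B.smax + κ₁ * (π * Real.sqrt 2 + 2 * B.smax) / (B.Dtmin - κ₁)) ^ 2 + (8 + 2 * κ₁) * ((4 + κ₁) * (π * Real.sqrt 2) / (B.Dtmin - κ₁)) + (4 + κ₁) * (π * Real.sqrt 2)) / (B.Dtmin - κ₁)) + 2 * ((4 + κ₁) * (π * Real.sqrt 2) / (B.Dtmin - κ₁)) + π * Real.sqrt 2) + κ₁ * ((((4 + κ₂) * (B.smax + κ₁ * (π * Real.sqrt 2 + 2 * B.smax) / (B.Dtmin - κ₁)) ^ 2 + (8 + 2 * κ₁) * ((4 + κ₁) * (π * Real.sqrt 2) / (B.Dtmin - κ₁)) + (4 + κ₁) * (π * Real.sqrt 2)) / (B.Dtmin - κ₁)) + 2 * ((4 + κ₁) * (π * Real.sqrt 2) / (B.Dtmin - κ₁)) + π * Real.sqrt 2) / 2)) * τ ^ 2 ≤ η₀ / 2) (hτlam : ((8 * (B.smax + κ₁ * (π * Real.sqrt 2 + 2 * B.smax) / (B.Dtmin - κ₁)) ^ 2 + 2 * (κ₂ * (B.smax + κ₁ * (π * Real.sqrt 2 + 2 *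 B.smax) / (B.Dtmin - κ₁)) ^ 2) + 4 * ((((4 + κ₂) * (B.smax + κ₁ * (π * Real.sqrt 2 + 2 * B.smax) / (B.Dtmin - κ₁)) ^ 2 + (8 + 2 * κ₁) * ((4 + κ₁) * (π * Real.sqrt 2) / (B.Dtmin - κ₁)) + (4 + κ₁) * (π * Real.sqrt 2)) / (B.Dtmin - κ₁)) + 2 * ((4 + κ₁) * (π * Real.sqrt 2) / (B.Dtmin - κ₁)) + π * Real.sqrt 2) + κ₁ * ((((4 + κ₂) * (B.smax + κ₁ * (π * Real.sqrt 2 + 2 * B.smax) / (B.Dtmin - κ₁)) ^ 2 + (8 + 2 * κ₁) * ((4 + κ₁) * (π * Real.sqrt 2) / (B.Dtmin - κ₁)) + (4 + κ₁) * (π * Real.sqrt 2)) / (B.Dtmin - κ₁)) + 2 * ((4 + κ₁) * (π * Real.sqrt 2) / (B.Dtmin - κ₁)) + π * Real.sqrt 2))) * τ ≤ 2 * lam)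
    (hDlo : δ₀ + δ₁ * τ < hfunE δ u μ P σ σ) (hDhi : hfunE δ u μ P σ σ ≤ η₀ / 2)
    (hG0 : |h3E δ u P σ σ + h3E δ u P σ σ| ≤ 2 * lam)
    (hI : ∀ x ∈ Icc (σ - τ / 2) (σ + τ / 2),
      ι ≤ -(Real.sin (SXE u P σ σ) * Real.sin (XE u x) + Real.sin (SYE u P σ σ) * Real.sin (YE u x)))
    (hι : 2 * (B.smax + κ₁ * (π * Real.sqrt 2 + 2 * B.smax) / (B.Dtmin - κ₁)) * τ < ι) :
    ((Finset.range ⌊τ / w⌋₊).filter fun i : ℕ =>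
        |hfunE δ u μ P (σ - (w + i * w) / 2) (σ + (w + i * w) / 2)| ≤ δ₀ + δ₁ * (w + i * w)).card = 0 := by
  set F : ℝ → ℝ := fun t => hfunE δ u μ P (σ - t / 2) (σ + t / 2) with hF
  set F' : ℝ → ℝ := fun t => Real.sin (SXE u P (σ - t / 2) (σ + t / 2)) * (VXE u (σ + t / 2) - VXE u (σ - t / 2)) +
        Real.sin (SYE u P (σ - t / 2) (σ + t / 2)) * (VYE u (σ + t / 2) - VYE u (σ - t / 2)) +
        fderiv ℝ δ (momE u P (σ - t / 2) (σ + t / 2))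
          ![(VXE u (σ + t / 2) - VXE u (σ - t / 2)) / 2, (VYE u (σ + t / 2) - VYE u (σ - t / 2)) / 2] with hF'
  have hFd : ∀ t, HasDerivAt F (F' t) t := hasDerivAt_hfunE_anti B hδs hδ hlo hhi hκ hκ₁ hu P σ
  have hF0 : F 0 = hfunE δ u μ P σ σ := by simp only [hF, zero_div, sub_zero, add_zero]
  have hδτ : 0 ≤ δ₁ * τ := by positivity
  have hSE0 : 0 ≤ (B.smax + κ₁ * (π * Real.sqrt 2 + 2 * B.smax) / (B.Dtmin - κ₁)) := by
    have h2ne : (2 : WithTop ℕ∞) ≠ 0 := by norm_num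
    obtain ⟨hvx, -⟩ := abs_VXE_le B hδs h2ne (fun k _ => hδ k) hlo hhi (fun k _ => hκ k) hκ₁ hu σ
    exact (abs_nonneg _).trans hvx
  -- on the whole row: `|F t| ≤ η₀` and `|G t| ≤ 4λ`
  have hrow : ∀ t, 0 ≤ t → t ≤ τ → |F t| ≤ η₀ ∧
      |h3E δ u P (σ + t / 2) (σ - t / 2) + h3E δ u P (σ - t / 2) (σ + t / 2)| ≤ 4 * lam := by
    intro t ht0 htτ
    have hbd : ∀ s ∈ Icc 0 t, |F' s| ≤ ((2 * ((((4 + κ₂) * (B.smax + κ₁ * (π * Real.sqrt 2 + 2 * B.smax) / (B.Dtmin - κ₁)) ^ 2 + (8 + 2 * κ₁) * ((4 + κ₁) * (π * Real.sqrt 2) / (B.Dtmin - κ₁)) + (4 + κ₁) * (π * Real.sqrt 2)) / (B.Dtmin - κ₁)) + 2 * ((4 + κ₁) * (π * Real.sqrt 2) / (B.Dtmin - κ₁)) + π * Real.sqrt 2) + κ₁ * ((((4 + κ₂) * (B.smax + κ₁ * (π * Real.sqrt 2 + 2 * B.smax) / (B.Dtmin - κ₁)) ^ 2 + (8 + 2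 * κ₁) * ((4 + κ₁) * (π * Real.sqrt 2) / (B.Dtmin - κ₁)) + (4 + κ₁) * (π * Real.sqrt 2)) / (B.Dtmin - κ₁)) + 2 * ((4 + κ₁) * (π * Real.sqrt 2) / (B.Dtmin - κ₁)) + π * Real.sqrt 2) / 2)) * τ := fun s hs =>
      (abs_anti_derivE_le B hδs hδ hlo hhi hκ hκ₁ hκ₂ hu P σ s).trans (by
        rw [abs_of_nonneg hs.1]; exact mul_le_mul_of_nonneg_left (hs.2.trans htτ) hM.le)
    have hvar := abs_sub_le_of_abs_deriv_le hFd hbd (z := t) ⟨ht0, le_rfl⟩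
    have hFt : |F t| ≤ η₀ := by
      have h1 := abs_sub_abs_le_abs_sub (F t) (F 0)
      have hF0' : |F 0| ≤ η₀ / 2 := by
        rw [hF0, abs_le]; constructor <;> linarith
      have hq : ((2 * ((((4 + κ₂) * (B.smax + κ₁ * (π * Real.sqrt 2 + 2 * B.smax) / (B.Dtmin - κ₁)) ^ 2 + (8 + 2 * κ₁) * ((4 + κ₁) * (π * Real.sqrt 2) / (B.Dtmin - κ₁)) + (4 + κ₁) * (π * Real.sqrt 2)) / (B.Dtmin - κ₁)) + 2 * ((4 + κ₁) * (π * Real.sqrt 2) / (B.Dtmin - κ₁)) + π * Real.sqrt 2) + κ₁ * ((((4 + κ₂) * (B.smax + κ₁ * (π * Real.sqrt 2 + 2 * B.smax) / (B.Dtmin - κ₁)) ^ 2 + (8 + 2 * κ₁) * ((4 + κ₁) * (π * Real.sqrt 2) / (B.Dtmin - κ₁)) + (4 + κ₁) * (π * Real.sqrt 2)) / (B.Dtmin - κ₁)) + 2 * ((4 + κ₁) * (π * Real.sqrt 2) / (B.Dtmin - κ₁)) + π * Real.sqrt 2) / 2)) * τ * (t - 0) ≤ ((2 * ((((4 + κ₂)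 * (B.smax + κ₁ * (π * Real.sqrt 2 + 2 * B.smax) / (B.Dtmin - κ₁)) ^ 2 + (8 + 2 * κ₁) * ((4 + κ₁) * (π * Real.sqrt 2) / (B.Dtmin - κ₁)) + (4 + κ₁) * (π * Real.sqrt 2)) / (B.Dtmin - κ₁)) + 2 * ((4 + κ₁) * (π * Real.sqrt 2) / (B.Dtmin - κ₁)) + π * Real.sqrt 2) + κ₁ * ((((4 + κ₂) * (B.smax + κ₁ * (π * Real.sqrt 2 + 2 * B.smax) / (B.Dtmin - κ₁)) ^ 2 + (8 + 2 * κ₁) * ((4 + κ₁) * (π * Real.sqrt 2) / (B.Dtmin - κ₁)) + (4 + κ₁) * (π * Real.sqrt 2)) / (B.Dtmin - κ₁)) + 2 * ((4 + κ₁) * (π * Real.sqrt 2) / (B.Dtmin - κ₁)) + π * Real.sqrt 2) / 2)) * τ ^ 2 :=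
        calc ((2 * ((((4 + κ₂) * (B.smax + κ₁ * (π * Real.sqrt 2 + 2 * B.smax) / (B.Dtmin - κ₁)) ^ 2 + (8 + 2 * κ₁) * ((4 + κ₁) * (π * Real.sqrt 2) / (B.Dtmin - κ₁)) + (4 + κ₁) * (π * Real.sqrt 2)) / (B.Dtmin - κ₁)) + 2 * ((4 + κ₁) * (π * Real.sqrt 2) / (B.Dtmin - κ₁)) + π * Real.sqrt 2) + κ₁ * ((((4 + κ₂) * (B.smax + κ₁ * (π * Real.sqrt 2 + 2 * B.smax) / (B.Dtmin - κ₁)) ^ 2 + (8 + 2 * κ₁) * ((4 + κ₁) * (π * Real.sqrt 2) / (B.Dtmin - κ₁)) + (4 + κ₁) * (π * Real.sqrt 2)) / (B.Dtmin - κ₁)) + 2 * ((4 + κ₁) * (π * Real.sqrt 2) / (B.Dtmin - κ₁)) + π * Real.sqrt 2) / 2)) * τ * (t - 0) = ((2 * ((((4 + κ₂) * (B.smax + κ₁ * (π * Real.sqrt 2 + 2 * B.smax) / (B.Dtmin - κ₁)) ^ 2 + (8 + 2 * κ₁) * ((4 + κ₁) * (π * Real.sqrt 2) / (B.Dtmin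 - κ₁)) + (4 + κ₁) * (π * Real.sqrt 2)) / (B.Dtmin - κ₁)) + 2 * ((4 + κ₁) * (π * Real.sqrt 2) / (B.Dtmin - κ₁)) + π * Real.sqrt 2) + κ₁ * ((((4 + κ₂) * (B.smax + κ₁ * (π * Real.sqrt 2 + 2 * B.smax) / (B.Dtmin - κ₁)) ^ 2 + (8 + 2 * κ₁) * ((4 + κ₁) * (π * Real.sqrt 2) / (B.Dtmin - κ₁)) + (4 + κ₁) * (π * Real.sqrt 2)) / (B.Dtmin - κ₁)) + 2 * ((4 + κ₁) * (π * Real.sqrt 2) / (B.Dtmin - κ₁)) + π * Real.sqrt 2) / 2)) * τ * t := by rw [sub_zero]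
          _ ≤ ((2 * ((((4 + κ₂) * (B.smax + κ₁ * (π * Real.sqrt 2 + 2 * B.smax) / (B.Dtmin - κ₁)) ^ 2 + (8 + 2 * κ₁) * ((4 + κ₁) * (π * Real.sqrt 2) / (B.Dtmin - κ₁)) + (4 + κ₁) * (π * Real.sqrt 2)) / (B.Dtmin - κ₁)) + 2 * ((4 + κ₁) * (π * Real.sqrt 2) / (B.Dtmin - κ₁)) + π * Real.sqrt 2) + κ₁ * ((((4 + κ₂) * (B.smax + κ₁ * (π * Real.sqrt 2 + 2 * B.smax) / (B.Dtmin - κ₁)) ^ 2 + (8 + 2 * κ₁) * ((4 + κ₁) * (π * Real.sqrt 2) / (B.Dtmin - κ₁)) + (4 + κ₁) * (π * Real.sqrt 2)) / (B.Dtmin - κ₁)) + 2 * ((4 + κ₁) * (π * Real.sqrt 2) / (B.Dtmin - κ₁)) + π * Real.sqrt 2) / 2)) * τ * τ := mul_le_mul_of_nonneg_left htτ (mul_nonneg hM.le hτ.le)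
          _ = ((2 * ((((4 + κ₂) * (B.smax + κ₁ * (π * Real.sqrt 2 + 2 * B.smax) / (B.Dtmin - κ₁)) ^ 2 + (8 + 2 * κ₁) * ((4 + κ₁) * (π * Real.sqrt 2) / (B.Dtmin - κ₁)) + (4 + κ₁) * (π * Real.sqrt 2)) / (B.Dtmin - κ₁)) + 2 * ((4 + κ₁) * (π * Real.sqrt 2) / (B.Dtmin - κ₁)) + π * Real.sqrt 2) + κ₁ * ((((4 + κ₂) * (B.smax + κ₁ * (π * Real.sqrt 2 + 2 * B.smax) / (B.Dtmin - κ₁)) ^ 2 + (8 + 2 * κ₁) * ((4 + κ₁) * (π * Real.sqrt 2) / (B.Dtmin - κ₁)) + (4 + κ₁) * (π * Real.sqrt 2)) / (B.Dtmin - κ₁)) + 2 * ((4 + κ₁) * (π * Real.sqrt 2) / (B.Dtmin - κ₁)) + π * Real.sqrt 2) / 2)) * τ ^ 2 := by rw [pow_two τ]; exact mul_assoc _ _ _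
      linarith
    have hGt : |h3E δ u P (σ + t / 2) (σ - t / 2) + h3E δ u P (σ - t / 2) (σ + t / 2)| ≤ 4 * lam := by
      have hg := abs_G_sub_le B hδs hδ hlo hhi hκ hκ₁ hκ₂ hu P σ t 0
      simp only [zero_div, add_zero, sub_zero] at hg
      rw [abs_of_nonneg ht0] at hg
      have h1 := abs_sub_abs_le_abs_sub (h3E δ u P (σ + t / 2) (σ - t / 2) + h3E δ u P (σ - t / 2) (σ + t / 2))
        (h3E δ u P σ σ + h3E δ u P σ σ)
      have hq : ((8 * (B.smax + κ₁ * (π * Real.sqrt 2 + 2 * B.smax) / (B.Dtmin - κ₁)) ^ 2 + 2 * (κ₂ * (B.smax + κ₁ * (π * Real.sqrt 2 + 2 * B.smax) / (B.Dtmin - κ₁)) ^ 2) + 4 * ((((4 + κ₂) * (B.smax + κ₁ * (π * Real.sqrt 2 + 2 * B.smax) / (B.Dtmin - κ₁)) ^ 2 + (8 + 2 * κ₁) * ((4 + κ₁) * (π * Real.sqrt 2) / (B.Dtmin - κ₁)) + (4 + κ₁) * (π * Real.sqrt 2)) / (B.Dtmin - κ₁)) + 2 * ((4 + κ₁) * (π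 * Real.sqrt 2) / (B.Dtmin - κ₁)) + π * Real.sqrt 2) + κ₁ * ((((4 + κ₂) * (B.smax + κ₁ * (π * Real.sqrt 2 + 2 * B.smax) / (B.Dtmin - κ₁)) ^ 2 + (8 + 2 * κ₁) * ((4 + κ₁) * (π * Real.sqrt 2) / (B.Dtmin - κ₁)) + (4 + κ₁) * (π * Real.sqrt 2)) / (B.Dtmin - κ₁)) + 2 * ((4 + κ₁) * (π * Real.sqrt 2) / (B.Dtmin - κ₁)) + π * Real.sqrt 2))) * t ≤ ((8 * (B.smax + κ₁ * (π * Real.sqrt 2 + 2 * B.smax) / (B.Dtmin - κ₁)) ^ 2 + 2 * (κ₂ * (B.smax + κ₁ * (π * Real.sqrt 2 + 2 * B.smax) / (B.Dtmin - κ₁)) ^ 2) + 4 * ((((4 + κ₂) * (B.smax + κ₁ * (π * Real.sqrt 2 + 2 * B.smax) / (B.Dtmin - κ₁)) ^ 2 + (8 + 2 * κ₁) * ((4 + κ₁) * (π * Real.sqrt 2) / (B.Dtmin - κ₁)) + (4 + κ₁) * (π * Real.sqrt 2)) / (B.Dtmin - κ₁)) + 2 * ((4 + κ₁) * (π * Real.sqrt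 2) / (B.Dtmin - κ₁)) + π * Real.sqrt 2) + κ₁ * ((((4 + κ₂) * (B.smax + κ₁ * (π * Real.sqrt 2 + 2 * B.smax) / (B.Dtmin - κ₁)) ^ 2 + (8 + 2 * κ₁) * ((4 + κ₁) * (π * Real.sqrt 2) / (B.Dtmin - κ₁)) + (4 + κ₁) * (π * Real.sqrt 2)) / (B.Dtmin - κ₁)) + 2 * ((4 + κ₁) * (π * Real.sqrt 2) / (B.Dtmin - κ₁)) + π * Real.sqrt 2))) * τ := mul_le_mul_of_nonneg_left htτ hMG.le
      linarith
    exact ⟨hFt, hGt⟩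
  -- hence `F' ≥ 0` on `[0, τ]`
  have hmono : ∀ t, 0 ≤ t → t ≤ τ → 0 ≤ F' t := by
    intro t ht0 htτ
    rcases eq_or_lt_of_le ht0 with h0 | hpos
    · rw [← h0, hF']
      simp only [zero_div, sub_zero, add_zero, sub_self, mul_zero, zero_add]
      have hz : (![(0 : ℝ), 0] : Fin 2 → ℝ) = 0 := by ext i; fin_cases i <;> rfl
      rw [hz, map_zero]
    · obtain ⟨hFt, hGt⟩ := hrow t ht0 htτ
      obtain ⟨dX, dY, -⟩ := abs_SXE_sub_le B hδs hδ hlo hhi hκ hκ₁ hu P (σ - t / 2) (σ + t / 2) σ σ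
      rw [show σ - t / 2 - σ = -(t / 2) by ring, show σ + t / 2 - σ = t / 2 by ring, abs_neg,
        abs_of_pos (half_pos hpos), add_halves] at dX dY
      have sX := (Real.abs_sin_sub_sin_le _ _).trans dX
      have sY := (Real.abs_sin_sub_sin_le _ _).trans dY
      have hIt : ∀ x ∈ Icc (σ - τ / 2) (σ + τ / 2), ι - 2 * (B.smax + κ₁ * (π * Real.sqrt 2 + 2 * B.smax) / (B.Dtmin - κ₁)) * τ ≤
          (-1) * (Real.sin (SXE u P (σ - t / 2) (σ + t / 2)) * Real.sin (XE u x) +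
            Real.sin (SYE u P (σ - t / 2) (σ + t / 2)) * Real.sin (YE u x)) := by
        intro x hx
        have h0 := hI x hx
        have e : (-1) * (Real.sin (SXE u P (σ - t / 2) (σ + t / 2)) * Real.sin (XE u x) +
            Real.sin (SYE u P (σ - t / 2) (σ + t / 2)) * Real.sin (YE u x)) =
            -(Real.sin (SXE u P σ σ) * Real.sin (XE u x) + Real.sin (SYE u P σ σ) * Real.sin (YE u x)) -
              ((Real.sin (SXE u P (σ - t / 2) (σ + t / 2)) - Real.sin (SXE u P σ σ)) * Real.sin (XE u x) +
                (Real.sin (SYE u P (σ - t / 2) (σ + t / 2)) - Real.sin (SYE u P σ σ)) * Real.sin (YE u x)) := by ring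
        have b := abs_two_term_le sX (Real.abs_sin_le_one (XE u x)) sY (Real.abs_sin_le_one (YE u x))
        have b' := le_abs_self ((Real.sin (SXE u P (σ - t / 2) (σ + t / 2)) - Real.sin (SXE u P σ σ)) * Real.sin (XE u x) +
                (Real.sin (SYE u P (σ - t / 2) (σ + t / 2)) - Real.sin (SYE u P σ σ)) * Real.sin (YE u x))
        have hq : (B.smax + κ₁ * (π * Real.sqrt 2 + 2 * B.smax) / (B.Dtmin - κ₁)) * t ≤ (B.smax + κ₁ * (π * Real.sqrt 2 + 2 * B.smax) / (B.Dtmin - κ₁)) * τ := mul_le_mul_of_nonneg_left htτ hSE0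
        rw [e]; linarith only [h0, b, b', hq]
      have hkey := anti_key_perturbed_signed B hδs hδ hlo hhi hκ hκ₁ hκ₂ hu (s := -1) (Or.inr rfl) hpos htτ hlo' hhi' hFt hGt
        hsmall hρ (by linarith only [hι] : 0 < ι - 2 * (B.smax + κ₁ * (π * Real.sqrt 2 + 2 * B.smax) / (B.Dtmin - κ₁)) * τ) hIt
      have hh := B.hmin_pos
      rw [hF']
      have : 0 ≤ B.hmin / 2 * t := by positivity
      linarith only [hkey, this]
  -- `δ₀ + δ₁τ < F 0` and the one-sided count
  have hδ₀F : δ₀ + δ₁ * τ < F 0 := by rw [hF0]; exact hDlo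
  have hK : ((⌊τ / w⌋₊ : ℕ) : ℝ) * w ≤ τ := by
    have := Nat.floor_le (div_nonneg hτ.le hw.le) (a := τ / w)
    rwa [le_div_iff₀ hw] at this
  have hzero := gridCount_oneSided_incr hFd hmono hδ₀F hw hK
  rw [Finset.card_eq_zero, Finset.filter_eq_empty_iff] at hzero ⊢
  intro i hi hle
  refine hzero hi (hle.trans ?_)
  have hi' : (i : ℝ) + 1 ≤ ⌊τ / w⌋₊ := by exact_mod_cast Nat.succ_le_of_lt (Finset.mem_range.1 hi)
  have hiw : w + i * w ≤ τ := by
    have := mul_le_mul_of_nonneg_right hi' hw.le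
    linarith only [this, hK]
  linarith only [mul_le_mul_of_nonneg_left hiw hδ₁]


/-- **Row kill on the perturbed curve, aligned row below the band** (mirror of `row_kill_anti_perturbed`): `h^E_P(σ,σ) < −(δ₀ + δ₁τ)`, `≥ −η₀/2`,
aligned with margin `ι > 2S_Eτ`; then `F′ ≤ 0` on `[0, τ]` and no cell of the row is admissible. [cite: BenfattoGiulianiMastropietro2006, App. A2] -/
theorem row_kill_aligned_perturbed {P : ℝ × ℝ} {σ w τ η₀ lam ι δ₀ δ₁ : ℝ} (hw : 0 < w) (hτ : 0 < τ) (hδ₀ : 0 ≤ δ₀) (hδ₁ : 0 ≤ δ₁)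
    (hlo' : a ≤ μ - κ₀ - η₀) (hhi' : μ + κ₀ + η₀ ≤ b)
    (hsmall :
      4 * (κ₁ * (π * Real.sqrt 2 + 2 * B.smax) / (B.Dtmin - κ₁)) * ((B.smax + κ₁ * (π * Real.sqrt 2 + 2 * B.smax) / (B.Dtmin - κ₁)) + B.smax) +
          (κ₂ * (B.smax + κ₁ * (π * Real.sqrt 2 + 2 * B.smax) / (B.Dtmin - κ₁)) ^ 2 + κ₁ * ((((4 + κ₂) * (B.smax + κ₁ * (π * Real.sqrt 2 + 2 * B.smax) / (B.Dtmin - κ₁)) ^ 2 + (8 + 2 * κ₁) * ((4 + κ₁) * (π * Real.sqrt 2) / (B.Dtmin - κ₁)) + (4 + κ₁) * (π * Real.sqrt 2)) / (B.Dtmin - κ₁)) + 2 * ((4 + κ₁) * (π * Real.sqrt 2) / (B.Dtmin - κ₁)) + π * Real.sqrt 2)) / 2 +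
        2 * ((((4 + κ₂) * (B.smax + κ₁ * (π * Real.sqrt 2 + 2 * B.smax) / (B.Dtmin - κ₁)) ^ 2 + (8 + 2 * κ₁) * ((4 + κ₁) * (π * Real.sqrt 2) / (B.Dtmin - κ₁)) + (4 + κ₁) * (π * Real.sqrt 2)) / (B.Dtmin - κ₁)) + 2 * ((4 + κ₁) * (π * Real.sqrt 2) / (B.Dtmin - κ₁)) + π * Real.sqrt 2) *
          (η₀ / B.Dtmin + 2 * κ₀ / B.Dtmin + B.smax * (B.Cg * ((2 * lam + (4 + κ₁) * ((((4 + κ₂) * (B.smax + κ₁ * (π * Real.sqrt 2 + 2 * B.smax) / (B.Dtmin - κ₁)) ^ 2 + (8 + 2 * κ₁) * ((4 + κ₁) * (π * Real.sqrt 2) / (B.Dtmin - κ₁)) + (4 + κ₁) * (π * Real.sqrt 2)) / (B.Dtmin - κ₁)) + 2 * ((4 + κ₁) * (π * Real.sqrt 2) / (B.Dtmin - κ₁)) + π * Real.sqrt 2) * τ / 2) / 2 + κ₁ * (B.smax + κ₁ * (π * Real.sqrt 2 + 2 * B.smax) / (B.Dtmin - κ₁)) / 2 + 2 * (κ₁ *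 (π * Real.sqrt 2 + 2 * B.smax) / (B.Dtmin - κ₁)) + 2 * B.smax * (η₀ / B.Dtmin) + 2 * B.smax * (2 * κ₀ / B.Dtmin)) + τ / 2)) +
        κ₁ * ((((4 + κ₂) * (B.smax + κ₁ * (π * Real.sqrt 2 + 2 * B.smax) / (B.Dtmin - κ₁)) ^ 2 + (8 + 2 * κ₁) * ((4 + κ₁) * (π * Real.sqrt 2) / (B.Dtmin - κ₁)) + (4 + κ₁) * (π * Real.sqrt 2)) / (B.Dtmin - κ₁)) + 2 * ((4 + κ₁) * (π * Real.sqrt 2) / (B.Dtmin - κ₁)) + π * Real.sqrt 2) / 2 ≤ B.hmin / 2)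
    (hρ : 2 * (η₀ / B.Dtmin + 2 * κ₀ / B.Dtmin + B.smax * (B.Cg * ((2 * lam + (4 + κ₁) * ((((4 + κ₂) * (B.smax + κ₁ * (π * Real.sqrt 2 + 2 * B.smax) / (B.Dtmin - κ₁)) ^ 2 + (8 + 2 * κ₁) * ((4 + κ₁) * (π * Real.sqrt 2) / (B.Dtmin - κ₁)) + (4 + κ₁) * (π * Real.sqrt 2)) / (B.Dtmin - κ₁)) + 2 * ((4 + κ₁) * (π * Real.sqrt 2) / (B.Dtmin - κ₁)) + π * Real.sqrt 2) * τ / 2) / 2 + κ₁ * (B.smax + κ₁ * (π * Real.sqrt 2 + 2 * B.smax) / (B.Dtmin - κ₁)) / 2 + 2 * (κ₁ * (π * Real.sqrt 2 + 2 * B.smax) / (B.Dtmin - κ₁)) + 2 * B.smax * (η₀ / B.Dtmin) + 2 * B.smax * (2 * κ₀ / B.Dtmin)) + τ / 2)) < B.rhomin ^ 2)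
    (hM : 0 < (2 * ((((4 + κ₂) * (B.smax + κ₁ * (π * Real.sqrt 2 + 2 * B.smax) / (B.Dtmin - κ₁)) ^ 2 + (8 + 2 * κ₁) * ((4 + κ₁) * (π * Real.sqrt 2) / (B.Dtmin - κ₁)) + (4 + κ₁) * (π * Real.sqrt 2)) / (B.Dtmin - κ₁)) + 2 * ((4 + κ₁) * (π * Real.sqrt 2) / (B.Dtmin - κ₁)) + π * Real.sqrt 2) + κ₁ * ((((4 + κ₂) * (B.smax + κ₁ * (π * Real.sqrt 2 + 2 * B.smax) / (B.Dtmin - κ₁)) ^ 2 + (8 + 2 * κ₁) * ((4 + κ₁) * (π * Real.sqrt 2) / (B.Dtmin - κ₁)) + (4 + κ₁) * (π * Real.sqrt 2)) / (B.Dtmin - κ₁)) + 2 * ((4 + κ₁) * (π * Real.sqrt 2) / (B.Dtmin - κ₁)) + π * Real.sqrt 2) / 2)) (hMG : 0 < (8 * (B.smax + κ₁ * (π * Real.sqrt 2 + 2 * B.smax) / (B.Dtmin - κ₁)) ^ 2 + 2 * (κ₂ * (B.smax + κ₁ * (π * Real.sqrt 2 + 2 * B.smax) / (B.Dtmin - κ₁))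 ^ 2) + 4 * ((((4 + κ₂) * (B.smax + κ₁ * (π * Real.sqrt 2 + 2 * B.smax) / (B.Dtmin - κ₁)) ^ 2 + (8 + 2 * κ₁) * ((4 + κ₁) * (π * Real.sqrt 2) / (B.Dtmin - κ₁)) + (4 + κ₁) * (π * Real.sqrt 2)) / (B.Dtmin - κ₁)) + 2 * ((4 + κ₁) * (π * Real.sqrt 2) / (B.Dtmin - κ₁)) + π * Real.sqrt 2) + κ₁ * ((((4 + κ₂) * (B.smax + κ₁ * (π * Real.sqrt 2 + 2 * B.smax) / (B.Dtmin - κ₁)) ^ 2 + (8 + 2 * κ₁) * ((4 + κ₁) * (π * Real.sqrt 2) / (B.Dtmin - κ₁)) + (4 + κ₁) * (π * Real.sqrt 2)) / (B.Dtmin - κ₁)) + 2 * ((4 + κ₁) * (π * Real.sqrt 2) / (B.Dtmin - κ₁)) + π * Real.sqrt 2)))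
    (hτη : ((2 * ((((4 + κ₂) * (B.smax + κ₁ * (π * Real.sqrt 2 + 2 * B.smax) / (B.Dtmin - κ₁)) ^ 2 + (8 + 2 * κ₁) * ((4 + κ₁) * (π * Real.sqrt 2) / (B.Dtmin - κ₁)) + (4 + κ₁) * (π * Real.sqrt 2)) / (B.Dtmin - κ₁)) + 2 * ((4 + κ₁) * (π * Real.sqrt 2) / (B.Dtmin - κ₁)) + π * Real.sqrt 2) + κ₁ * ((((4 + κ₂) * (B.smax + κ₁ * (π * Real.sqrt 2 + 2 * B.smax) / (B.Dtmin - κ₁)) ^ 2 + (8 + 2 * κ₁) * ((4 + κ₁) * (π * Real.sqrt 2) / (B.Dtmin - κ₁)) + (4 + κ₁) * (π * Real.sqrt 2)) / (B.Dtmin - κ₁)) + 2 * ((4 + κ₁) * (π * Real.sqrt 2) / (B.Dtmin - κ₁)) + π * Real.sqrt 2) / 2)) * τ ^ 2 ≤ η₀ / 2) (hτlam : ((8 * (B.smax + κ₁ * (π * Real.sqrt 2 + 2 * B.smax) / (B.Dtmin - κ₁)) ^ 2 + 2 * (κ₂ * (B.smax + κ₁ * (π * Real.sqrt 2 + 2 *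 B.smax) / (B.Dtmin - κ₁)) ^ 2) + 4 * ((((4 + κ₂) * (B.smax + κ₁ * (π * Real.sqrt 2 + 2 * B.smax) / (B.Dtmin - κ₁)) ^ 2 + (8 + 2 * κ₁) * ((4 + κ₁) * (π * Real.sqrt 2) / (B.Dtmin - κ₁)) + (4 + κ₁) * (π * Real.sqrt 2)) / (B.Dtmin - κ₁)) + 2 * ((4 + κ₁) * (π * Real.sqrt 2) / (B.Dtmin - κ₁)) + π * Real.sqrt 2) + κ₁ * ((((4 + κ₂) * (B.smax + κ₁ * (π * Real.sqrt 2 + 2 * B.smax) / (B.Dtmin - κ₁)) ^ 2 + (8 + 2 * κ₁) * ((4 + κ₁) * (π * Real.sqrt 2) / (B.Dtmin - κ₁)) + (4 + κ₁) * (π * Real.sqrt 2)) / (B.Dtmin - κ₁)) + 2 * ((4 + κ₁) * (π * Real.sqrt 2) / (B.Dtmin - κ₁)) + π * Real.sqrt 2))) * τ ≤ 2 * lam)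
    (hDhi : hfunE δ u μ P σ σ < -(δ₀ + δ₁ * τ)) (hDlo : -(η₀ / 2) ≤ hfunE δ u μ P σ σ)
    (hG0 : |h3E δ u P σ σ + h3E δ u P σ σ| ≤ 2 * lam)
    (hI : ∀ x ∈ Icc (σ - τ / 2) (σ + τ / 2),
      ι ≤ Real.sin (SXE u P σ σ) * Real.sin (XE u x) + Real.sin (SYE u P σ σ) * Real.sin (YE u x))
    (hι : 2 * (B.smax + κ₁ * (π * Real.sqrt 2 + 2 * B.smax) / (B.Dtmin - κ₁)) * τ < ι) :
    ((Finset.range ⌊τ / w⌋₊).filter fun i : ℕ =>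
        |hfunE δ u μ P (σ - (w + i * w) / 2) (σ + (w + i * w) / 2)| ≤ δ₀ + δ₁ * (w + i * w)).card = 0 := by
  set F : ℝ → ℝ := fun t => hfunE δ u μ P (σ - t / 2) (σ + t / 2) with hF
  set F' : ℝ → ℝ := fun t => Real.sin (SXE u P (σ - t / 2) (σ + t / 2)) * (VXE u (σ + t / 2) - VXE u (σ - t / 2)) +
        Real.sin (SYE u P (σ - t / 2) (σ + t / 2)) * (VYE u (σ + t / 2) - VYE u (σ - t / 2)) +
        fderiv ℝ δ (momE u P (σ - t / 2) (σ + t / 2))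
          ![(VXE u (σ + t / 2) - VXE u (σ - t / 2)) / 2, (VYE u (σ + t / 2) - VYE u (σ - t / 2)) / 2] with hF'
  have hFd : ∀ t, HasDerivAt F (F' t) t := hasDerivAt_hfunE_anti B hδs hδ hlo hhi hκ hκ₁ hu P σ
  have hF0 : F 0 = hfunE δ u μ P σ σ := by simp only [hF, zero_div, sub_zero, add_zero]
  have hδτ : 0 ≤ δ₁ * τ := by positivity
  have hSE0 : 0 ≤ (B.smax + κ₁ * (π * Real.sqrt 2 + 2 * B.smax) / (B.Dtmin - κ₁)) := by
    have h2ne : (2 : WithTop ℕ∞) ≠ 0 := by norm_num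
    obtain ⟨hvx, -⟩ := abs_VXE_le B hδs h2ne (fun k _ => hδ k) hlo hhi (fun k _ => hκ k) hκ₁ hu σ
    exact (abs_nonneg _).trans hvx
  -- on the whole row: `|F t| ≤ η₀` and `|G t| ≤ 4λ`
  have hrow : ∀ t, 0 ≤ t → t ≤ τ → |F t| ≤ η₀ ∧
      |h3E δ u P (σ + t / 2) (σ - t / 2) + h3E δ u P (σ - t / 2) (σ + t / 2)| ≤ 4 * lam := by
    intro t ht0 htτ
    have hbd : ∀ s ∈ Icc 0 t, |F' s| ≤ ((2 * ((((4 + κ₂) * (B.smax + κ₁ * (π * Real.sqrt 2 + 2 * B.smax) / (B.Dtmin - κ₁)) ^ 2 + (8 + 2 * κ₁) * ((4 + κ₁) * (π * Real.sqrt 2) / (B.Dtmin - κ₁)) + (4 + κ₁) * (π * Real.sqrt 2)) / (B.Dtmin - κ₁)) + 2 * ((4 + κ₁) * (π * Real.sqrt 2) / (B.Dtmin - κ₁)) + π * Real.sqrt 2) + κ₁ * ((((4 + κ₂) * (B.smax + κ₁ * (π * Real.sqrt 2 + 2 * B.smax) / (B.Dtmin - κ₁)) ^ 2 + (8 + 2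 * κ₁) * ((4 + κ₁) * (π * Real.sqrt 2) / (B.Dtmin - κ₁)) + (4 + κ₁) * (π * Real.sqrt 2)) / (B.Dtmin - κ₁)) + 2 * ((4 + κ₁) * (π * Real.sqrt 2) / (B.Dtmin - κ₁)) + π * Real.sqrt 2) / 2)) * τ := fun s hs =>
      (abs_anti_derivE_le B hδs hδ hlo hhi hκ hκ₁ hκ₂ hu P σ s).trans (by
        rw [abs_of_nonneg hs.1]; exact mul_le_mul_of_nonneg_left (hs.2.trans htτ) hM.le)
    have hvar := abs_sub_le_of_abs_deriv_le hFd hbd (z := t) ⟨ht0, le_rfl⟩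
    have hFt : |F t| ≤ η₀ := by
      have h1 := abs_sub_abs_le_abs_sub (F t) (F 0)
      have hF0' : |F 0| ≤ η₀ / 2 := by
        rw [hF0, abs_le]; constructor <;> linarith
      have hq : ((2 * ((((4 + κ₂) * (B.smax + κ₁ * (π * Real.sqrt 2 + 2 * B.smax) / (B.Dtmin - κ₁)) ^ 2 + (8 + 2 * κ₁) * ((4 + κ₁) * (π * Real.sqrt 2) / (B.Dtmin - κ₁)) + (4 + κ₁) * (π * Real.sqrt 2)) / (B.Dtmin - κ₁)) + 2 * ((4 + κ₁) * (π * Real.sqrt 2) / (B.Dtmin - κ₁)) + π * Real.sqrt 2) + κ₁ * ((((4 + κ₂) * (B.smax + κ₁ * (π * Real.sqrt 2 + 2 * B.smax) / (B.Dtmin - κ₁)) ^ 2 + (8 + 2 * κ₁) * ((4 + κ₁) * (π * Real.sqrt 2) / (B.Dtmin - κ₁)) + (4 + κ₁) * (π * Real.sqrt 2)) / (B.Dtmin - κ₁)) + 2 * ((4 + κ₁) * (π * Real.sqrt 2) / (B.Dtmin - κ₁)) + π * Real.sqrt 2) / 2)) * τ * (t - 0) ≤ ((2 * ((((4 + κ₂)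 * (B.smax + κ₁ * (π * Real.sqrt 2 + 2 * B.smax) / (B.Dtmin - κ₁)) ^ 2 + (8 + 2 * κ₁) * ((4 + κ₁) * (π * Real.sqrt 2) / (B.Dtmin - κ₁)) + (4 + κ₁) * (π * Real.sqrt 2)) / (B.Dtmin - κ₁)) + 2 * ((4 + κ₁) * (π * Real.sqrt 2) / (B.Dtmin - κ₁)) + π * Real.sqrt 2) + κ₁ * ((((4 + κ₂) * (B.smax + κ₁ * (π * Real.sqrt 2 + 2 * B.smax) / (B.Dtmin - κ₁)) ^ 2 + (8 + 2 * κ₁) * ((4 + κ₁) * (π * Real.sqrt 2) / (B.Dtmin - κ₁)) + (4 + κ₁) * (π * Real.sqrt 2)) / (B.Dtmin - κ₁)) + 2 * ((4 + κ₁) * (π * Real.sqrt 2) / (B.Dtmin - κ₁)) + π * Real.sqrt 2) / 2)) * τ ^ 2 :=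
        calc ((2 * ((((4 + κ₂) * (B.smax + κ₁ * (π * Real.sqrt 2 + 2 * B.smax) / (B.Dtmin - κ₁)) ^ 2 + (8 + 2 * κ₁) * ((4 + κ₁) * (π * Real.sqrt 2) / (B.Dtmin - κ₁)) + (4 + κ₁) * (π * Real.sqrt 2)) / (B.Dtmin - κ₁)) + 2 * ((4 + κ₁) * (π * Real.sqrt 2) / (B.Dtmin - κ₁)) + π * Real.sqrt 2) + κ₁ * ((((4 + κ₂) * (B.smax + κ₁ * (π * Real.sqrt 2 + 2 * B.smax) / (B.Dtmin - κ₁)) ^ 2 + (8 + 2 * κ₁) * ((4 + κ₁) * (π * Real.sqrt 2) / (B.Dtmin - κ₁)) + (4 + κ₁) * (π * Real.sqrt 2)) / (B.Dtmin - κ₁)) + 2 * ((4 + κ₁) * (π * Real.sqrt 2) / (B.Dtmin - κ₁)) + π * Real.sqrt 2) / 2)) * τ * (t - 0) = ((2 * ((((4 + κ₂) * (B.smax + κ₁ * (π * Real.sqrt 2 + 2 * B.smax) / (B.Dtmin - κ₁)) ^ 2 + (8 + 2 * κ₁) * ((4 + κ₁) * (π * Real.sqrt 2) / (B.Dtmin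 - κ₁)) + (4 + κ₁) * (π * Real.sqrt 2)) / (B.Dtmin - κ₁)) + 2 * ((4 + κ₁) * (π * Real.sqrt 2) / (B.Dtmin - κ₁)) + π * Real.sqrt 2) + κ₁ * ((((4 + κ₂) * (B.smax + κ₁ * (π * Real.sqrt 2 + 2 * B.smax) / (B.Dtmin - κ₁)) ^ 2 + (8 + 2 * κ₁) * ((4 + κ₁) * (π * Real.sqrt 2) / (B.Dtmin - κ₁)) + (4 + κ₁) * (π * Real.sqrt 2)) / (B.Dtmin - κ₁)) + 2 * ((4 + κ₁) * (π * Real.sqrt 2) / (B.Dtmin - κ₁)) + π * Real.sqrt 2) / 2)) * τ * t := by rw [sub_zero]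
          _ ≤ ((2 * ((((4 + κ₂) * (B.smax + κ₁ * (π * Real.sqrt 2 + 2 * B.smax) / (B.Dtmin - κ₁)) ^ 2 + (8 + 2 * κ₁) * ((4 + κ₁) * (π * Real.sqrt 2) / (B.Dtmin - κ₁)) + (4 + κ₁) * (π * Real.sqrt 2)) / (B.Dtmin - κ₁)) + 2 * ((4 + κ₁) * (π * Real.sqrt 2) / (B.Dtmin - κ₁)) + π * Real.sqrt 2) + κ₁ * ((((4 + κ₂) * (B.smax + κ₁ * (π * Real.sqrt 2 + 2 * B.smax) / (B.Dtmin - κ₁)) ^ 2 + (8 + 2 * κ₁) * ((4 + κ₁) * (π * Real.sqrt 2) / (B.Dtmin - κ₁)) + (4 + κ₁) * (π * Real.sqrt 2)) / (B.Dtmin - κ₁)) + 2 * ((4 + κ₁) * (π * Real.sqrt 2) / (B.Dtmin - κ₁)) + π * Real.sqrt 2) / 2)) * τ * τ := mul_le_mul_of_nonneg_left htτ (mul_nonneg hM.le hτ.le)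
          _ = ((2 * ((((4 + κ₂) * (B.smax + κ₁ * (π * Real.sqrt 2 + 2 * B.smax) / (B.Dtmin - κ₁)) ^ 2 + (8 + 2 * κ₁) * ((4 + κ₁) * (π * Real.sqrt 2) / (B.Dtmin - κ₁)) + (4 + κ₁) * (π * Real.sqrt 2)) / (B.Dtmin - κ₁)) + 2 * ((4 + κ₁) * (π * Real.sqrt 2) / (B.Dtmin - κ₁)) + π * Real.sqrt 2) + κ₁ * ((((4 + κ₂) * (B.smax + κ₁ * (π * Real.sqrt 2 + 2 * B.smax) / (B.Dtmin - κ₁)) ^ 2 + (8 + 2 * κ₁) * ((4 + κ₁) * (π * Real.sqrt 2) / (B.Dtmin - κ₁)) + (4 + κ₁) * (π * Real.sqrt 2)) / (B.Dtmin - κ₁)) + 2 * ((4 + κ₁) * (π * Real.sqrt 2) / (B.Dtmin - κ₁)) + π * Real.sqrt 2) / 2)) * τ ^ 2 := by rw [pow_two τ]; exact mul_assoc _ _ _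
      linarith
    have hGt : |h3E δ u P (σ + t / 2) (σ - t / 2) + h3E δ u P (σ - t / 2) (σ + t / 2)| ≤ 4 * lam := by
      have hg := abs_G_sub_le B hδs hδ hlo hhi hκ hκ₁ hκ₂ hu P σ t 0
      simp only [zero_div, add_zero, sub_zero] at hg
      rw [abs_of_nonneg ht0] at hg
      have h1 := abs_sub_abs_le_abs_sub (h3E δ u P (σ + t / 2) (σ - t / 2) + h3E δ u P (σ - t / 2) (σ + t / 2))
        (h3E δ u P σ σ + h3E δ u P σ σ)
      have hq : ((8 * (B.smax + κ₁ * (π * Real.sqrt 2 + 2 * B.smax) / (B.Dtmin - κ₁)) ^ 2 + 2 * (κ₂ * (B.smax + κ₁ * (π * Real.sqrt 2 + 2 * B.smax) / (B.Dtmin - κ₁)) ^ 2) + 4 * ((((4 + κ₂) * (B.smax + κ₁ * (π * Real.sqrt 2 + 2 * B.smax) / (B.Dtmin - κ₁)) ^ 2 + (8 + 2 * κ₁) * ((4 + κ₁) * (π * Real.sqrt 2) / (B.Dtmin - κ₁)) + (4 + κ₁) * (π * Real.sqrt 2)) / (B.Dtmin - κ₁)) + 2 * ((4 + κ₁) * (π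 * Real.sqrt 2) / (B.Dtmin - κ₁)) + π * Real.sqrt 2) + κ₁ * ((((4 + κ₂) * (B.smax + κ₁ * (π * Real.sqrt 2 + 2 * B.smax) / (B.Dtmin - κ₁)) ^ 2 + (8 + 2 * κ₁) * ((4 + κ₁) * (π * Real.sqrt 2) / (B.Dtmin - κ₁)) + (4 + κ₁) * (π * Real.sqrt 2)) / (B.Dtmin - κ₁)) + 2 * ((4 + κ₁) * (π * Real.sqrt 2) / (B.Dtmin - κ₁)) + π * Real.sqrt 2))) * t ≤ ((8 * (B.smax + κ₁ * (π * Real.sqrt 2 + 2 * B.smax) / (B.Dtmin - κ₁)) ^ 2 + 2 * (κ₂ * (B.smax + κ₁ * (π * Real.sqrt 2 + 2 * B.smax) / (B.Dtmin - κ₁)) ^ 2) + 4 * ((((4 + κ₂) * (B.smax + κ₁ * (π * Real.sqrt 2 + 2 * B.smax) / (B.Dtmin - κ₁)) ^ 2 + (8 + 2 * κ₁) * ((4 + κ₁) * (π * Real.sqrt 2) / (B.Dtmin - κ₁)) + (4 + κ₁) * (π * Real.sqrt 2)) / (B.Dtmin - κ₁)) + 2 * ((4 + κ₁) * (π * Real.sqrt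 2) / (B.Dtmin - κ₁)) + π * Real.sqrt 2) + κ₁ * ((((4 + κ₂) * (B.smax + κ₁ * (π * Real.sqrt 2 + 2 * B.smax) / (B.Dtmin - κ₁)) ^ 2 + (8 + 2 * κ₁) * ((4 + κ₁) * (π * Real.sqrt 2) / (B.Dtmin - κ₁)) + (4 + κ₁) * (π * Real.sqrt 2)) / (B.Dtmin - κ₁)) + 2 * ((4 + κ₁) * (π * Real.sqrt 2) / (B.Dtmin - κ₁)) + π * Real.sqrt 2))) * τ := mul_le_mul_of_nonneg_left htτ hMG.le
      linarith
    exact ⟨hFt, hGt⟩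
  -- hence `F' ≤ 0` on `[0, τ]`
  have hmono : ∀ t, 0 ≤ t → t ≤ τ → F' t ≤ 0 := by
    intro t ht0 htτ
    rcases eq_or_lt_of_le ht0 with h0 | hpos
    · rw [← h0, hF']
      simp only [zero_div, sub_zero, add_zero, sub_self, mul_zero, zero_add]
      have hz : (![(0 : ℝ), 0] : Fin 2 → ℝ) = 0 := by ext i; fin_cases i <;> rfl
      rw [hz, map_zero]
    · obtain ⟨hFt, hGt⟩ := hrow t ht0 htτ
      obtain ⟨dX, dY, -⟩ := abs_SXE_sub_le B hδs hδ hlo hhi hκ hκ₁ hu P (σ - t / 2) (σ + t / 2) σ σ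
      rw [show σ - t / 2 - σ = -(t / 2) by ring, show σ + t / 2 - σ = t / 2 by ring, abs_neg,
        abs_of_pos (half_pos hpos), add_halves] at dX dY
      have sX := (Real.abs_sin_sub_sin_le _ _).trans dX
      have sY := (Real.abs_sin_sub_sin_le _ _).trans dY
      have hIt : ∀ x ∈ Icc (σ - τ / 2) (σ + τ / 2), ι - 2 * (B.smax + κ₁ * (π * Real.sqrt 2 + 2 * B.smax) / (B.Dtmin - κ₁)) * τ ≤
          (1 : ℝ) * (Real.sin (SXE u P (σ - t / 2) (σ + t / 2)) * Real.sin (XE u x) +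
            Real.sin (SYE u P (σ - t / 2) (σ + t / 2)) * Real.sin (YE u x)) := by
        intro x hx
        have h0 := hI x hx
        have e : (1 : ℝ) * (Real.sin (SXE u P (σ - t / 2) (σ + t / 2)) * Real.sin (XE u x) +
            Real.sin (SYE u P (σ - t / 2) (σ + t / 2)) * Real.sin (YE u x)) =
            (Real.sin (SXE u P σ σ) * Real.sin (XE u x) + Real.sin (SYE u P σ σ) * Real.sin (YE u x)) +
              ((Real.sin (SXE u P (σ - t / 2) (σ + t / 2)) - Real.sin (SXE u P σ σ)) * Real.sin (XE u x) +
                (Real.sin (SYE u P (σ - t / 2) (σ + t / 2)) - Real.sin (SYE u P σ σ)) * Real.sin (YE u x)) := by ring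
        have b := abs_two_term_le sX (Real.abs_sin_le_one (XE u x)) sY (Real.abs_sin_le_one (YE u x))
        have b' := neg_abs_le ((Real.sin (SXE u P (σ - t / 2) (σ + t / 2)) - Real.sin (SXE u P σ σ)) * Real.sin (XE u x) +
                (Real.sin (SYE u P (σ - t / 2) (σ + t / 2)) - Real.sin (SYE u P σ σ)) * Real.sin (YE u x))
        have hq : (B.smax + κ₁ * (π * Real.sqrt 2 + 2 * B.smax) / (B.Dtmin - κ₁)) * t ≤ (B.smax + κ₁ * (π * Real.sqrt 2 + 2 * B.smax) / (B.Dtmin - κ₁)) * τ := mul_le_mul_of_nonneg_left htτ hSE0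
        rw [e]; linarith only [h0, b, b', hq]
      have hkey := anti_key_perturbed_signed B hδs hδ hlo hhi hκ hκ₁ hκ₂ hu (s := 1) (Or.inl rfl) hpos htτ hlo' hhi' hFt hGt
        hsmall hρ (by linarith only [hι] : 0 < ι - 2 * (B.smax + κ₁ * (π * Real.sqrt 2 + 2 * B.smax) / (B.Dtmin - κ₁)) * τ) hIt
      have hh := B.hmin_pos
      rw [hF']
      have : 0 ≤ B.hmin / 2 * t := by positivity
      linarith only [hkey, this]
  -- `F 0 < -(δ₀ + δ₁τ)` and the one-sided count
  have hδ₀F : F 0 < -(δ₀ + δ₁ * τ) := by rw [hF0]; exact hDhi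
  have hK : ((⌊τ / w⌋₊ : ℕ) : ℝ) * w ≤ τ := by
    have := Nat.floor_le (div_nonneg hτ.le hw.le) (a := τ / w)
    rwa [le_div_iff₀ hw] at this
  have hzero := gridCount_oneSided_decr hFd hmono hδ₀F hw hK
  rw [Finset.card_eq_zero, Finset.filter_eq_empty_iff] at hzero ⊢
  intro i hi hle
  refine hzero hi (hle.trans ?_)
  have hi' : (i : ℝ) + 1 ≤ ⌊τ / w⌋₊ := by exact_mod_cast Nat.succ_le_of_lt (Finset.mem_range.1 hi)
  have hiw : w + i * w ≤ τ := by
    have := mul_le_mul_of_nonneg_right hi' hw.le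
    linarith only [this, hK]
  linarith only [mul_le_mul_of_nonneg_left hiw hδ₁]

end RowKill

end Summit.HubbardSuperconductivity.HubbardSuperconductivity.Theorems.PerturbedFermiCurve

end
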